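import Literature.MathematicalPhysics.QuantumFieldTheory.Balaban1983to89.B9Eq3102LeibnizCommutatorAveraging
import Literature.MathematicalPhysics.QuantumFieldTheory.Balaban1983to89.B9Eq387IMSLocalLettersLattice

/-!
# `Balaban1983to89.B9Eq387IMSAveragingLettersLattice` — T. Bałaban, *Propagators for lattice gauge theories in a background field*, Commun. Math. Phys.
# **99** (1985) 389–434 [Balaban1985BackgroundPropagators] p. 408, (3.87)–(3.89) p. 409, (3.102) p. 414, (3.15)–(3.16) p. 393, with [Balaban1984PropagatorsI]
# (1.118) p. 36: **THE IMS LETTERS OF KERNEL 7's THIRD LOCAL LETTER `T₃ = √a·Q` AT THE LATTICE, FLAT POINT** — on the NE9 chain's weighted carriers of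
# `W`-valued 1-forms: the single-commutator letter `‖χ_E^jQ(1)f − Q(1)χ_S^jf‖ ≤ ℓ′√(c₁∕(c₀L^d))‖f‖`, **`a₃ ≤ Θ·c₁∕(c₀L^d)`**, **`k₃ ≤ Θ·√(c₁∕(c₀L^d))`**,
# **`t₃k₃ ≤ Θ·c₁∕(c₀L^d)`** (Θ = the sweep energy of the partition; NO `η`, NO volume, NO fibre constant), THE (dn) ROW
# `Σ_j ‖Q(1)(χ_S^jf)‖² ≤ ‖Q(1)f‖² + 2Θ·(c₁∕(c₀L^d))·‖f‖²` via ne9-leaf-01's (D) `B9Eq387IMSLocalLettersLattice.sum_norm_sq_apply_localised_le` (also for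
# `a′·Q(1)`), and THE TREE's PARTITION `B5SmoothPartition.hS`: sweep energy `≤ 256d(L−1)²∕M₀²` — instance-ledger rows L5 ∕ L6 ∕ L7 of `t4/ROUTES-NE9.md`
# v13.33 for `i = 3`, route R2′ STEP B8′ (S-P7 «IMS assembly»)

statement-level skeleton of published theorems with citation tags; proofs where landed; nothing here is a claim about the Yang–Mills mass gap

CITATION HEADER (lean-in-tree rule).  Audit cell `pub-balaban`, sub-cell `t4`, BINDER row NE9; filed by NE9 formalisation-swarm LEAF PROVER 01
(`b2b-balaban-t4-ne9-formalise-leaf-01`, gen 82) as the third of three files (`B9Eq315QFlatSweep` — the sweeps and the `L²` transfer;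
`B9Eq3102LeibnizCommutatorAveraging` — the pointwise Leibniz letters; THIS — the carrier letters), the `i = 3` sibling of the same lineage's (D)
`B9Eq387IMSLocalLettersLattice` (rows L3∕L4∕L6∕L7 for `T₁ = D_U`, `T₂ = D*_U` over NE9 leaf-04's `B9Eq3100LeibnizCommutator*`), with the partition energy
from the same lineage's kernel-9 port `B9Eq387ProductPartitionBondEnergy` (t4-ne9-idea-1 gen 95's kernel).  Sources READ by this seat in the held text
`paper:balaban1985-cmp99-background-propagators` (journal page = PDF page + 388): p. 393 (3.15)–(3.16), p. 408, p. 409 (3.87)–(3.89), p. 414 (3.101)–(3.103).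

THE PRINT (verbatim).  p. 408: *«We take the partition of unity {h_□} defined at the end of Sect. A in [4]. We have Σ_{□∈𝒟} h²_□ = 1.»*; p. 414,
(3.102): *«(Q_jhA)(c) = h(c₋)(Q_jA)(c) + Σ_b L^{−jd}Q_j(c,b)(∂h)(Γ_{c₋,b₋})A(b) = h(c₋)(Q_jA)(c) + (S_j(∂h)A)(c)»*, (3.103): *«(Q*aQhA)(b) =
h(b₋)(Q*aQA)(b) − (S*(∂h)aQA)(b) + (Q*aS(∂h)A)(b)»*, and l. 1–3: *«They are of the order O(M⁻¹), or O(M⁻²), if considered on a proper scale.»*  Print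
localises `Δ_a` through parametrices (3.87) and these commutators; the IMS bookkeeping (`Σ_j ‖T(χ_jx)‖²` against `‖Tx‖²` with the double commutator) is the
ROUTE's device for the same partition (kernel 7), NOT print's road; nothing of [B9] is asserted.

WHY (route R2′ STEP B8′, S-P7; instance ledger `t4/ROUTES-NE9.md` v13.33 l. 435–448, rows L5∕L6∕L7 ✗ for `i = 3`).  `B9Eq387IMSAssembly.ims_assembly_strong`
needs for `T₃` the letters `t₃`, `a₃`, the product `t₃k₃` and the (dn) shape; (D) §2 `sum_norm_sq_apply_localised_le` turns «`Σ_j ‖ad_jTx‖² ≤ a‖x‖²` +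
`‖Tx‖·‖Σ_j ad_j(ad_jT)x‖ ≤ tk‖x‖²`» into the (dn) row.  This file supplies exactly those two hypotheses for `T = Q(1)` from the pointwise letters of
`B9Eq3102LeibnizCommutatorAveraging` and the transfer of `B9Eq315QFlatSweep`, applies (D) §2, and inhabits the energy hypothesis for the tree's partition.

WHAT IS PROVED (sorry-free; proof lane — no `def`, no `Prop` placeholder; [folklore] composition of landed families; nothing of [B9] asserted).  Setting as in
the two parents: `QtorusW … (fun _ => 1) …` under the tree's displayed regularity letters; cutoff CLMs `χ_S^j` ∕ `χ_E^j` acting pointwise as `χ_j(b₋)` ∕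
`χ_j(π c)` (hypotheses `hS`, `hE`); weights `c₀` (fine), `c₁` (coarse).
* §1 LETTERS: `norm_comm_QtorusW_one_le` (single cutoff, oscillation `ℓ′`: `≤ ℓ′√(c₁∕(c₀L^d))‖f‖` — the additive twin of leaf-05's (I4) `norm_mulOp_Qtilde_sub_le`),
  **`sum_norm_sq_comm_QtorusW_one_le`** (`a₃`: `Σ_j ‖χ_E^jQ(1)f − Q(1)χ_S^jf‖² ≤ Θ·(c₁∕(c₀L^d))·‖f‖²`), **`norm_sum_comm_comm_QtorusW_one_le`** (`k₃`:
  `‖Σ_j […]‖ ≤ Θ√(c₁∕(c₀L^d))‖f‖`), **`norm_mul_norm_sum_comm_comm_QtorusW_one_le`** (`t₃k₃`: `‖Q(1)f‖·‖Σ_j […]‖ ≤ Θ·(c₁∕(c₀L^d))·‖f‖²`).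
* §2 THE (dn) ROW: **`sum_norm_sq_QtorusW_one_localised_le`** (`Σ_j χ_j² = 1`, energy `≤ Θ` ⟹ `Σ_j ‖Q(1)(χ_S^jf)‖² ≤ ‖Q(1)f‖² + (Θ + Θ)·(c₁∕(c₀L^d))·‖f‖²`, by
  (D) §2 at `T := Q(1)` as a CLM), `sum_norm_sq_smul_QtorusW_one_localised_le` (the same for `a′·Q(1)`, any `a′ : ℂ` — kernel 7's `√a·Q`).
* §3 THE TREE's PARTITION (`B5SmoothPartition.hS (L·m) M₀`, `1 ≤ M₀`, `M₀ ∣ L·m_i`, `2M₀ ≤ L·m_i`; coarse sampling at the block corner `L·c₋ = π c`):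
  `sum_gS_sub_sq_le` (the kernel-9 port's 1-D letter for an arbitrary pair of residues: `≤ 4·(4·dist∕M₀)²`), `circAbs_sweep_le` (a sweep site is within
  circular distance `2(L−1)` of the corner in every coordinate), **`sum_hS_sweep_sq_le`** (sweep energy `≤ 256d(L−1)²∕M₀²`, by the port's subadditivity
  `sum_hS_sub_sq_le_sum`), **`sum_norm_sq_QtorusW_one_localised_le_smooth`** (the (dn) row for the tree's partition: `+ 2·256d(L−1)²∕M₀²·(c₁∕(c₀L^d))·‖f‖²`).
THE `η`-BOOKKEEPING (words): `M₀ = M∕η` sites, `L = 1∕η` at the point `Lη = 1`, so `256d(L−1)²∕M₀² ≤ 256d∕M²`: the `T₃` rows cost `O(d∕M²)` at `c₁ = c₀L^d`,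
with NO net `η` and no volume — [B9] p. 414 «O(M⁻²) … on a proper scale».  What is NOT here: the general background (`Q(U) = Q(1) + E`, `‖E‖ ≤ θ_Q` by
`B9Eq315QLipschitzL2.norm_QtorusW_sub_flat_le_local`; the IMS letters of a bounded perturbation are `a_E ≤ 4‖E‖²`, `k_E ≤ 4‖E‖` for ANY quadratic
partition — a sequel), the non-local letter `W` (S-P5(b)), the instance theorem L11, the choice of `M₀`.
HONEST SCOPE.  [folklore] composition BY NAME of landed theorems + threshold arithmetic; cutoffs hypothesised as CLMs (existence: (D) §1
`exists_pointwise_clm_family`), none minted (FREEZE e34b3e0c (0)); rows of ONE sub-step of a route step, NOT NE9 (cell pub-balaban: NE9 NOT PRINTED ∕ NOT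
PROVED; «NE9 ⇐ the named binders»; row WALLED ON A MODEL (O-NE9-1); spine PROVED 0∕9; rung (B)+1 on a finite T⁴ — NOT infinite volume, NOT mass gap, NOT
Clay; HONEST DEPENDENCY: continuum YM on T⁴ ⇐ BetaPertH ∧ nine spine estimates (0/9 proved); BetaPertH ⇐ (D1) ∧ (D4) ∧ CAP+tail; G-an2-4 gates asym, D1 and
NE2/3/4).  NEW file importing `B9Eq3102LeibnizCommutatorAveraging` and `B9Eq387IMSLocalLettersLattice`; nothing modified.  Net new unproved facts: 0.
-/

noncomputable section

open scoped BigOperators InnerProductSpace ComplexConjugate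
open Finset

namespace Literature.MathematicalPhysics.QuantumFieldTheory.Balaban1983to89.B9Eq387IMSAveragingLettersLattice

open B7Prop1Explicit (U1 Wcx boxVec e)
open B4Sect5Torus (TSite)
open B9SectCLatticeCarrier (Bond bpos)
open B9Eq319QprimeTorus (fineP)
open B9Eq311L2Pairing (WL2)
open B11Eq103H1Complex (BondL2K)
open B9Eq315QTorus (perSite perCfg cornerSite QtorusW)
open B9Eq315QFlatSweep (sum_norm_sq_le_of_sweep_bound norm_sq_le_of_sweep_bound norm_le_of_sweep_bound sq_sweep_mean_le norm_QtorusW_one_le)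
open B9Eq3102LeibnizCommutatorAveraging (norm_comm_QtorusW_one_apply_le sum_norm_sq_comm_QtorusW_one_apply_le norm_sq_sum_comm_comm_QtorusW_one_apply_le)
open B9Eq387IMSLocalLettersLattice (sum_norm_sq_apply_localised_le)

variable {d : ℕ} (L : ℕ) (m : Fin d → ℕ) [∀ i, NeZero (fineP L m i)] (hL : 1 ≤ L)
  {𝔸 : Type*} [NormedRing 𝔸] [NormOneClass 𝔸] [NormedAlgebra ℂ 𝔸] [CompleteSpace 𝔸]
  {α' : ℝ} (hα1' : α' ≤ 1 / 64)
  (hU1' : ∀ (x : B7Prop1Explicit.Site d) (κ : Fin d), perCfg (fineP L m) (fun _ : Bond d (fineP L m) => (1 : 𝔸ˣ)) x κ ∈ U1 𝔸)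
  (hreg' : ∀ (y : TSite d m) (κ : Fin d) (r : Fin d → Fin L),
    ‖((Wcx L (perCfg (fineP L m) (fun _ : Bond d (fineP L m) => (1 : 𝔸ˣ))) (cornerSite L y) κ (boxVec L r) : 𝔸ˣ) : 𝔸) - 1‖ ≤ α')
  {W : Type*} [NormedAddCommGroup W] [InnerProductSpace ℂ W] (φ : W ≃ₗ[ℂ] 𝔸) {c₀ c₁ : ℝ} [Fact (0 < c₀)] [Fact (0 < c₁)]

/-! ## §1 Rows L6∕L7 for `i = 3`: the commutator letters of `Q(1)` with one-site-sampled cutoffs on the carriers -/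

variable {J : Type*} (s : Finset J) (πc : Bond d m → TSite d (fineP L m)) (χ : J → TSite d (fineP L m) → ℝ)
  (χS : J → BondL2K ℂ d (fineP L m) c₀ W →L[ℂ] BondL2K ℂ d (fineP L m) c₀ W) (χE : J → BondL2K ℂ d m c₁ W →L[ℂ] BondL2K ℂ d m c₁ W)
  (hS : ∀ j (f : BondL2K ℂ d (fineP L m) c₀ W) (b : Bond d (fineP L m)), WL2.equiv ℂ _ W (χS j f) b = (χ j (bpos b) : ℂ) • WL2.equiv ℂ _ W f b)
  (hE : ∀ j (g : BondL2K ℂ d m c₁ W) (c : Bond d m), WL2.equiv ℂ _ W (χE j g) c = (χ j (πc c) : ℂ) • WL2.equiv ℂ _ W g c)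

include hS hE in
/-- **THE SINGLE-COMMUTATOR LETTER (row L6, i = 3)**: `|χ_j(π c) − χ_j(x)| ≤ ℓ′` over the sweep of every coarse bond ⟹
`‖χ_E^jQ(1)f − Q(1)χ_S^jf‖ ≤ ℓ′·√(c₁∕(c₀L^d))·‖f‖` — NO `η` (the additive twin of ne9-leaf-05's (I4) letter `norm_mulOp_Qtilde_sub_le` for `Q′`).
[folklore] [cite: Balaban1985BackgroundPropagators, (3.101)–(3.103) p.414, (3.15) p.393] -/
theorem norm_comm_QtorusW_one_le (j : J) {ℓ' : ℝ} (hℓ : 0 ≤ ℓ')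
    (hχ : ∀ (c : Bond d m) (r : Fin d → Fin L) (i : ℕ), i < L →
      |χ j (πc c) - χ j (perSite (fineP L m) (cornerSite L c.1 + boxVec L r + (i : ℤ) • e c.2))| ≤ ℓ')
    (f : BondL2K ℂ d (fineP L m) c₀ W) :
    ‖χE j (QtorusW L m hL φ (fun _ => 1) hα1' hU1' hreg' (c₁ := c₁) f) - QtorusW L m hL φ (fun _ => 1) hα1' hU1' hreg' (c₁ := c₁) (χS j f)‖ ≤
      ℓ' * Real.sqrt (c₁ / (c₀ * (L : ℝ) ^ d)) * ‖f‖ := by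
  refine norm_le_of_sweep_bound L m hL f _ hℓ fun c => ?_
  have h := norm_comm_QtorusW_one_apply_le L m hL hα1' hU1' hreg' φ πc χ χS χE hS hE j hχ f c (c₁ := c₁)
  have h0 : 0 ≤ ℓ' * (((L : ℝ) ^ (d + 1))⁻¹ * ∑ r : Fin d → Fin L, ∑ i ∈ Finset.range L,
      ‖WL2.equiv ℂ _ W f (perSite (fineP L m) (cornerSite L c.1 + boxVec L r + (i : ℤ) • e c.2), c.2)‖) := le_trans (norm_nonneg _) h
  calc _ ≤ (ℓ' * (((L : ℝ) ^ (d + 1))⁻¹ * ∑ r : Fin d → Fin L, ∑ i ∈ Finset.range L,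
          ‖WL2.equiv ℂ _ W f (perSite (fineP L m) (cornerSite L c.1 + boxVec L r + (i : ℤ) • e c.2), c.2)‖)) ^ 2 :=
        pow_le_pow_left₀ (norm_nonneg _) h 2
    _ ≤ ℓ' ^ 2 * (((L : ℝ) ^ (d + 1))⁻¹ * ∑ r : Fin d → Fin L, ∑ i ∈ Finset.range L,
          ‖WL2.equiv ℂ _ W f (perSite (fineP L m) (cornerSite L c.1 + boxVec L r + (i : ℤ) • e c.2), c.2)‖ ^ 2) := by
        rw [mul_pow]
        exact mul_le_mul_of_nonneg_left (sq_sweep_mean_le L hL _) (sq_nonneg _)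

include hS hE in
/-- **THE LETTER `a₃` (row L6, i = 3)**: sweep energy `Σ_j (χ_j(π c) − χ_j(x))² ≤ Θ` over the sweep of every coarse bond ⟹
`Σ_j ‖χ_E^jQ(1)f − Q(1)χ_S^jf‖² ≤ Θ·(c₁∕(c₀L^d))·‖f‖²` — NO `η`, NO volume, NO fibre constant. [folklore]
[cite: Balaban1985BackgroundPropagators, (3.101)–(3.103) p.414, p.408, (3.15) p.393] -/
theorem sum_norm_sq_comm_QtorusW_one_le {Θ : ℝ} (hΘ0 : 0 ≤ Θ)
    (hΘ : ∀ (c : Bond d m) (r : Fin d → Fin L) (i : ℕ), i < L →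
      ∑ j ∈ s, (χ j (πc c) - χ j (perSite (fineP L m) (cornerSite L c.1 + boxVec L r + (i : ℤ) • e c.2))) ^ 2 ≤ Θ)
    (f : BondL2K ℂ d (fineP L m) c₀ W) :
    ∑ j ∈ s, ‖χE j (QtorusW L m hL φ (fun _ => 1) hα1' hU1' hreg' (c₁ := c₁) f) -
        QtorusW L m hL φ (fun _ => 1) hα1' hU1' hreg' (c₁ := c₁) (χS j f)‖ ^ 2 ≤ Θ * (c₁ / (c₀ * (L : ℝ) ^ d)) * ‖f‖ ^ 2 :=
  sum_norm_sq_le_of_sweep_bound L m hL s f _ hΘ0 fun c => by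
    simpa using sum_norm_sq_comm_QtorusW_one_apply_le L m hL hα1' hU1' hreg' φ s πc χ χS χE hS hE hΘ f c (c₁ := c₁)

include hS hE in
/-- **THE LETTER `k₃` (row L7, i = 3)**: `‖Σ_j (χ_E^j(χ_E^jQ(1)f − Q(1)χ_S^jf) − (χ_E^jQ(1)χ_S^jf − Q(1)χ_S^jχ_S^jf))‖ ≤ Θ·√(c₁∕(c₀L^d))·‖f‖` — the family's
double-commutator sum is the sweep mean weighted by the sweep ENERGY (squares of increments: [B9] p. 414 «O(M⁻²)»). [folklore]
[cite: Balaban1985BackgroundPropagators, (3.101)–(3.103) p.414, p.408] -/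
theorem norm_sum_comm_comm_QtorusW_one_le {Θ : ℝ} (hΘ0 : 0 ≤ Θ)
    (hΘ : ∀ (c : Bond d m) (r : Fin d → Fin L) (i : ℕ), i < L →
      ∑ j ∈ s, (χ j (πc c) - χ j (perSite (fineP L m) (cornerSite L c.1 + boxVec L r + (i : ℤ) • e c.2))) ^ 2 ≤ Θ)
    (f : BondL2K ℂ d (fineP L m) c₀ W) :
    ‖∑ j ∈ s, ((χE j (χE j (QtorusW L m hL φ (fun _ => 1) hα1' hU1' hreg' (c₁ := c₁) f) -
        QtorusW L m hL φ (fun _ => 1) hα1' hU1' hreg' (c₁ := c₁) (χS j f))) -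
        (χE j (QtorusW L m hL φ (fun _ => 1) hα1' hU1' hreg' (c₁ := c₁) (χS j f)) -
          QtorusW L m hL φ (fun _ => 1) hα1' hU1' hreg' (c₁ := c₁) (χS j (χS j f))))‖ ≤
      Θ * Real.sqrt (c₁ / (c₀ * (L : ℝ) ^ d)) * ‖f‖ :=
  norm_le_of_sweep_bound L m hL f _ hΘ0 fun c =>
    norm_sq_sum_comm_comm_QtorusW_one_apply_le L m hL hα1' hU1' hreg' φ s πc χ χS χE hS hE hΘ f c (c₁ := c₁)

include hS hE in
/-- **THE PRODUCT `t₃k₃` (row L7, i = 3)** — the cross term kernel 7 consumes (`B9Eq387IMSAssembly`: no Young inequality):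
`‖Q(1)f‖·‖Σ_j […]‖ ≤ Θ·(c₁∕(c₀L^d))·‖f‖²`; for `T₃` there is no `η⁻¹` to cancel — `t₃` itself is bounded. [folklore]
[cite: Balaban1985BackgroundPropagators, (3.101)–(3.103) p.414, (3.15)–(3.16) p.393] -/
theorem norm_mul_norm_sum_comm_comm_QtorusW_one_le {Θ : ℝ} (hΘ0 : 0 ≤ Θ)
    (hΘ : ∀ (c : Bond d m) (r : Fin d → Fin L) (i : ℕ), i < L →
      ∑ j ∈ s, (χ j (πc c) - χ j (perSite (fineP L m) (cornerSite L c.1 + boxVec L r + (i : ℤ) • e c.2))) ^ 2 ≤ Θ)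
    (f : BondL2K ℂ d (fineP L m) c₀ W) :
    ‖QtorusW L m hL φ (fun _ => 1) hα1' hU1' hreg' (c₁ := c₁) f‖ *
      ‖∑ j ∈ s, ((χE j (χE j (QtorusW L m hL φ (fun _ => 1) hα1' hU1' hreg' (c₁ := c₁) f) -
        QtorusW L m hL φ (fun _ => 1) hα1' hU1' hreg' (c₁ := c₁) (χS j f))) -
        (χE j (QtorusW L m hL φ (fun _ => 1) hα1' hU1' hreg' (c₁ := c₁) (χS j f)) -
          QtorusW L m hL φ (fun _ => 1) hα1' hU1' hreg' (c₁ := c₁) (χS j (χS j f))))‖ ≤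
      Θ * (c₁ / (c₀ * (L : ℝ) ^ d)) * ‖f‖ ^ 2 := by
  have hc₀ : 0 < c₀ := Fact.out
  have hc₁ : 0 < c₁ := Fact.out
  have hr : 0 ≤ c₁ / (c₀ * (L : ℝ) ^ d) := by positivity
  have h1 := norm_QtorusW_one_le L m hL hα1' hU1' hreg' φ (c₁ := c₁) f
  have h2 := norm_sum_comm_comm_QtorusW_one_le L m hL hα1' hU1' hreg' φ s πc χ χS χE hS hE hΘ0 hΘ f (c₁ := c₁)
  calc _ ≤ (Real.sqrt (c₁ / (c₀ * (L : ℝ) ^ d)) * ‖f‖) * (Θ * Real.sqrt (c₁ / (c₀ * (L : ℝ) ^ d)) * ‖f‖) :=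
        mul_le_mul h1 h2 (norm_nonneg _) (by positivity)
    _ = Θ * (c₁ / (c₀ * (L : ℝ) ^ d)) * ‖f‖ ^ 2 := by
        rw [show ∀ a b t : ℝ, (a * b) * (t * a * b) = t * (a * a) * b ^ 2 from fun a b t => by ring, Real.mul_self_sqrt hr]

/-! ## §2 THE (dn) ROW OF KERNEL 7 FOR `T₃ ∝ Q(1)` — via ne9-leaf-01's (D) `B9Eq387IMSLocalLettersLattice.sum_norm_sq_apply_localised_le` -/

variable [FiniteDimensional ℂ W]

include hS hE in
/-- **ROW L5∕L6∕L7 AT THE LATTICE, FLAT POINT — THE (dn) LETTER OF `Q(1)`**: for a quadratic partition `Σ_j χ_j(x)² = 1` on the fine sites with sweep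
energy `≤ Θ`, its one-site-sampled multipliers `χ_S^j` (fine 1-forms, at `b₋`) and `χ_E^j` (coarse 1-forms, at `π c`) as CLMs, and every fine 1-form `f`:
`Σ_j ‖Q(1)(χ_S^jf)‖² ≤ ‖Q(1)f‖² + (Θ + Θ)·(c₁∕(c₀L^d))·‖f‖²` — the per-letter (dn) step of `B9Eq387IMSAssembly.ims_assembly_strong` with `t₃k₃ + a₃`.
[folklore] (IMS localisation) [cite: Balaban1985BackgroundPropagators, (3.101)–(3.103) p.414, p.408, (3.87)–(3.89) p.409, (3.15) p.393] -/
theorem sum_norm_sq_QtorusW_one_localised_le (hχ1 : ∀ x, ∑ j ∈ s, χ j x ^ 2 = 1) {Θ : ℝ} (hΘ0 : 0 ≤ Θ)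
    (hΘ : ∀ (c : Bond d m) (r : Fin d → Fin L) (i : ℕ), i < L →
      ∑ j ∈ s, (χ j (πc c) - χ j (perSite (fineP L m) (cornerSite L c.1 + boxVec L r + (i : ℤ) • e c.2))) ^ 2 ≤ Θ)
    (f : BondL2K ℂ d (fineP L m) c₀ W) :
    ∑ j ∈ s, ‖QtorusW L m hL φ (fun _ => 1) hα1' hU1' hreg' (c₁ := c₁) (χS j f)‖ ^ 2 ≤
      ‖QtorusW L m hL φ (fun _ => 1) hα1' hU1' hreg' (c₁ := c₁) f‖ ^ 2 +
        (Θ * (c₁ / (c₀ * (L : ℝ) ^ d)) + Θ * (c₁ / (c₀ * (L : ℝ) ^ d))) * ‖f‖ ^ 2 :=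
  sum_norm_sq_apply_localised_le s bpos πc χ χS χE hS hE hχ1
    (LinearMap.toContinuousLinearMap (QtorusW L m hL φ (fun _ => 1) hα1' hU1' hreg' (c₁ := c₁)))
    (fun f => sum_norm_sq_comm_QtorusW_one_le L m hL hα1' hU1' hreg' φ s πc χ χS χE hS hE hΘ0 hΘ f)
    (fun f => norm_mul_norm_sum_comm_comm_QtorusW_one_le L m hL hα1' hU1' hreg' φ s πc χ χS χE hS hE hΘ0 hΘ f) f

include hS hE in
/-- **THE SAME FOR `T₃ = a′·Q(1)`** (kernel 7's `√a·Q`; any scalar `a′ : ℂ`): `Σ_j ‖a′Q(1)(χ_S^jf)‖² ≤ ‖a′Q(1)f‖² + ‖a′‖²(Θ + Θ)·(c₁∕(c₀L^d))·‖f‖²`.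
[folklore] [cite: Balaban1985BackgroundPropagators, (3.26) p.395, (3.101)–(3.103) p.414, p.408] -/
theorem sum_norm_sq_smul_QtorusW_one_localised_le (hχ1 : ∀ x, ∑ j ∈ s, χ j x ^ 2 = 1) {Θ : ℝ} (hΘ0 : 0 ≤ Θ)
    (hΘ : ∀ (c : Bond d m) (r : Fin d → Fin L) (i : ℕ), i < L →
      ∑ j ∈ s, (χ j (πc c) - χ j (perSite (fineP L m) (cornerSite L c.1 + boxVec L r + (i : ℤ) • e c.2))) ^ 2 ≤ Θ)
    (a' : ℂ) (f : BondL2K ℂ d (fineP L m) c₀ W) :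
    ∑ j ∈ s, ‖a' • QtorusW L m hL φ (fun _ => 1) hα1' hU1' hreg' (c₁ := c₁) (χS j f)‖ ^ 2 ≤
      ‖a' • QtorusW L m hL φ (fun _ => 1) hα1' hU1' hreg' (c₁ := c₁) f‖ ^ 2 +
        ‖a'‖ ^ 2 * (Θ * (c₁ / (c₀ * (L : ℝ) ^ d)) + Θ * (c₁ / (c₀ * (L : ℝ) ^ d))) * ‖f‖ ^ 2 := by
  have h := sum_norm_sq_QtorusW_one_localised_le L m hL hα1' hU1' hreg' φ s πc χ χS χE hS hE hχ1 hΘ0 hΘ f (c₁ := c₁)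
  have h2 := mul_le_mul_of_nonneg_left h (sq_nonneg ‖a'‖)
  simp only [norm_smul, mul_pow, ← Finset.mul_sum]
  linarith

/-! ## §3 THE TREE's PARTITION `B5SmoothPartition.hS`: the sweep energy is `≤ 256d(L−1)²∕M₀²` -/

section Smooth

open B4TorusKernel.MultiPeriod (circAbs circAbs_add_mul circAbs_le_abs circAbs_nonneg)
open B5TorusCover (nC Ctr)
open B5SmoothPartition (gS sum_hS_sq abs_gS_sub_le)
open B9Eq387ProductPartitionBondEnergy (sum_hS_sub_sq_le_sum exists_support_gS_pair sum_sub_sq_le_card_mul_sq)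
open B9Eq315QFlatNorm (perSite_apply_val cornerSite_add_boxVec_apply)

omit [∀ i, NeZero (fineP L m i)] in
/-- the one-dimensional letter of the kernel-9 port for an ARBITRARY pair of residues: `Σ_k (g_k(t) − g_k(t′))² ≤ 4·(4·dist∕M₀)²`. [folklore]
[cite: Balaban1984PropagatorsI, (1.118) p.36] -/
theorem sum_gS_sub_sq_le {N M₀ : ℕ} (hN : 1 ≤ N) (hM : 1 ≤ M₀) (hdiv : M₀ ∣ N) (h2N : 2 * M₀ ≤ N) (t t' : Fin N) :
    ∑ k : Fin (nC N M₀), (gS N M₀ k t - gS N M₀ k t') ^ 2 ≤ 4 * (4 / (M₀ : ℝ) * (circAbs N ((t.val : ℤ) - (t'.val : ℤ)) : ℝ)) ^ 2 := by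
  classical
  obtain ⟨S, hS4, hS0⟩ := exists_support_gS_pair hM hdiv h2N t t'
  calc ∑ k, (gS N M₀ k t - gS N M₀ k t') ^ 2 ≤ S.card * (4 / (M₀ : ℝ) * (circAbs N ((t.val : ℤ) - (t'.val : ℤ)) : ℝ)) ^ 2 :=
        sum_sub_sq_le_card_mul_sq _ _ (fun k => abs_gS_sub_le hN hM k t t') S hS0
    _ ≤ 4 * (4 / (M₀ : ℝ) * (circAbs N ((t.val : ℤ) - (t'.val : ℤ)) : ℝ)) ^ 2 := by
        have h4 : (S.card : ℝ) ≤ 4 := by exact_mod_cast hS4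
        exact mul_le_mul_of_nonneg_right h4 (sq_nonneg _)

/-- **the circular offsets of the sweep**: the site `(L·y + r + ie_κ) mod L·m` is within circular distance `r_μ + i·[μ = κ] ≤ 2(L−1)` of the block
corner `L·y mod L·m` in every coordinate `μ`. [folklore] [cite: Balaban1985Averaging, (1)–(2) p.17] -/
theorem circAbs_sweep_le (y : TSite d m) (r : Fin d → Fin L) {i : ℕ} (hi : i < L) (κ μ : Fin d) :
    (circAbs (fineP L m μ) (((perSite (fineP L m) (cornerSite L y) μ).val : ℤ) -
        ((perSite (fineP L m) (cornerSite L y + boxVec L r + (i : ℤ) • e κ) μ).val : ℤ)) : ℝ) ≤ 2 * ((L : ℝ) - 1) := by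
  have hP : 1 ≤ fineP L m μ := Nat.one_le_iff_ne_zero.2 (NeZero.ne _)
  set P : ℕ := fineP L m μ with hPdef
  set a : ℤ := cornerSite L y μ with hadef
  set b : ℤ := (cornerSite L y + boxVec L r + (i : ℤ) • e κ) μ with hbdef
  have hrep : ((perSite (fineP L m) (cornerSite L y) μ).val : ℤ) - ((perSite (fineP L m) (cornerSite L y + boxVec L r + (i : ℤ) • e κ) μ).val : ℤ)
      = (a - b) + (P : ℤ) * (b / P - a / P) := by
    rw [perSite_apply_val, perSite_apply_val, ← hPdef, ← hadef, ← hbdef]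
    have ha := Int.emod_add_mul_ediv a P
    have hb := Int.emod_add_mul_ediv b P
    linear_combination ha - hb
  have hab : b - a = (r μ : ℕ) + (i : ℤ) * (if μ = κ then 1 else 0) := by
    rw [hbdef, hadef, Pi.add_apply, Pi.add_apply, Pi.smul_apply, B7Prop1Explicit.e_apply, boxVec, smul_eq_mul]
    ring
  rw [hrep, circAbs_add_mul]
  have h1 : (circAbs P (a - b) : ℝ) ≤ |((a - b : ℤ) : ℝ)| := by exact_mod_cast circAbs_le_abs hP (a - b)
  refine h1.trans ?_
  rw [show a - b = -(b - a) by ring, hab]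
  have hr : ((r μ : ℕ) : ℝ) ≤ (L : ℝ) - 1 := by
    have := (r μ).isLt
    have hL' : ((r μ : ℕ) : ℝ) + 1 ≤ L := by exact_mod_cast this
    linarith
  have hi' : (i : ℝ) ≤ (L : ℝ) - 1 := by
    have hL' : (i : ℝ) + 1 ≤ L := by exact_mod_cast hi
    linarith
  push_cast
  rw [abs_neg]
  split_ifs
  · rw [abs_of_nonneg (by positivity)]; linarith
  · rw [abs_of_nonneg (by positivity)]; linarith [(Nat.cast_nonneg i : (0 : ℝ) ≤ i)]

/-- **THE SWEEP ENERGY OF THE TREE's PARTITION**: for `B5SmoothPartition.hS (L·m) M₀` (`1 ≤ M₀`, `M₀ ∣ L·m_i`, `2M₀ ≤ L·m_i`), sampled on coarse bonds at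
the block corner, `Σ_z (h_z(L·y) − h_z(x))² ≤ 256d(L−1)²∕M₀²` for every site `x` of the sweep of `⟨y, y + e_κ⟩` (the kernel-9 port's subadditivity
`sum_hS_sub_sq_le_sum`, four profiles per coordinate, `|h′| ≤ 4∕M₀`, offsets `≤ 2(L−1)`); `M₀η = M` the physical cube side, so `O((L−1)²η²d∕M²)` — [B9]
p. 414 «O(M⁻²) … on a proper scale». [folklore] [cite: Balaban1984PropagatorsI, (1.118) p.36; Balaban1985BackgroundPropagators, p.408, p.414] -/
theorem sum_hS_sweep_sq_le {M₀ : ℕ} (hM : 1 ≤ M₀) (hdiv : ∀ i, M₀ ∣ fineP L m i) (h2N : ∀ i, 2 * M₀ ≤ fineP L m i)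
    (c : Bond d m) (r : Fin d → Fin L) {i : ℕ} (hi : i < L) :
    ∑ z : Ctr (fineP L m) M₀, (B5SmoothPartition.hS (fineP L m) M₀ z (perSite (fineP L m) (cornerSite L c.1)) -
        B5SmoothPartition.hS (fineP L m) M₀ z (perSite (fineP L m) (cornerSite L c.1 + boxVec L r + (i : ℤ) • e c.2))) ^ 2 ≤
      256 * d * ((L : ℝ) - 1) ^ 2 / (M₀ : ℝ) ^ 2 := by
  have hM0 : (0 : ℝ) < M₀ := by exact_mod_cast hM
  have h1 := sum_hS_sub_sq_le_sum hM hdiv h2N (perSite (fineP L m) (cornerSite L c.1))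
    (perSite (fineP L m) (cornerSite L c.1 + boxVec L r + (i : ℤ) • e c.2))
  refine h1.trans ?_
  have hμ : ∀ μ : Fin d, ∑ k : Fin (nC (fineP L m μ) M₀),
      (gS (fineP L m μ) M₀ k (perSite (fineP L m) (cornerSite L c.1) μ) -
        gS (fineP L m μ) M₀ k (perSite (fineP L m) (cornerSite L c.1 + boxVec L r + (i : ℤ) • e c.2) μ)) ^ 2 ≤
      256 * ((L : ℝ) - 1) ^ 2 / (M₀ : ℝ) ^ 2 := fun μ => by
    have hP : 1 ≤ fineP L m μ := Nat.one_le_iff_ne_zero.2 (NeZero.ne _)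
    have h2 := sum_gS_sub_sq_le hP hM (hdiv μ) (h2N μ) (perSite (fineP L m) (cornerSite L c.1) μ)
      (perSite (fineP L m) (cornerSite L c.1 + boxVec L r + (i : ℤ) • e c.2) μ)
    have h3 := circAbs_sweep_le L m c.1 r hi c.2 μ
    have h0 : (0 : ℝ) ≤ (circAbs (fineP L m μ) (((perSite (fineP L m) (cornerSite L c.1) μ).val : ℤ) -
        ((perSite (fineP L m) (cornerSite L c.1 + boxVec L r + (i : ℤ) • e c.2) μ).val : ℤ)) : ℝ) := by
      exact_mod_cast circAbs_nonneg hP _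
    have h4 : 4 / (M₀ : ℝ) * (circAbs (fineP L m μ) (((perSite (fineP L m) (cornerSite L c.1) μ).val : ℤ) -
        ((perSite (fineP L m) (cornerSite L c.1 + boxVec L r + (i : ℤ) • e c.2) μ).val : ℤ)) : ℝ) ≤ 4 / (M₀ : ℝ) * (2 * ((L : ℝ) - 1)) :=
      mul_le_mul_of_nonneg_left h3 (by positivity)
    have h5 := pow_le_pow_left₀ (mul_nonneg (by positivity) h0) h4 2
    calc _ ≤ 4 * (4 / (M₀ : ℝ) * (2 * ((L : ℝ) - 1))) ^ 2 := h2.trans (mul_le_mul_of_nonneg_left h5 (by norm_num))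
      _ = 256 * ((L : ℝ) - 1) ^ 2 / (M₀ : ℝ) ^ 2 := by field_simp; ring
  calc _ ≤ ∑ _μ : Fin d, 256 * ((L : ℝ) - 1) ^ 2 / (M₀ : ℝ) ^ 2 := Finset.sum_le_sum fun μ _ => hμ μ
    _ = 256 * d * ((L : ℝ) - 1) ^ 2 / (M₀ : ℝ) ^ 2 := by
        rw [Finset.sum_const, Finset.card_univ, Fintype.card_fin, nsmul_eq_mul]; ring

/-- **ROW L5∕L6∕L7 FOR THE TREE's PARTITION, FLAT POINT**: with `χ_z = B5SmoothPartition.hS (L·m) M₀` sampled at `b₋` on fine 1-forms and at the block corner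
`L·c₋` on coarse 1-forms, `Σ_z ‖Q(1)(χ_S^zf)‖² ≤ ‖Q(1)f‖² + 2·(256d(L−1)²∕M₀²)·(c₁∕(c₀L^d))·‖f‖²` — `= ‖Q(1)f‖² + 512d(L−1)²∕M₀²·‖f‖²` at `c₁ = c₀L^d`; with
`M₀ = M∕η`, `L = 1∕η`: `O(d∕M²)`, NO net `η`, NO volume. [folklore]
[cite: Balaban1985BackgroundPropagators, (3.101)–(3.103) p.414, p.408, (3.15) p.393; Balaban1984PropagatorsI, (1.118) p.36] -/
theorem sum_norm_sq_QtorusW_one_localised_le_smooth {M₀ : ℕ} (hM : 1 ≤ M₀) (hdiv : ∀ i, M₀ ∣ fineP L m i) (h2N : ∀ i, 2 * M₀ ≤ fineP L m i)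
    (χS' : Ctr (fineP L m) M₀ → BondL2K ℂ d (fineP L m) c₀ W →L[ℂ] BondL2K ℂ d (fineP L m) c₀ W)
    (χE' : Ctr (fineP L m) M₀ → BondL2K ℂ d m c₁ W →L[ℂ] BondL2K ℂ d m c₁ W)
    (hχS : ∀ z (f : BondL2K ℂ d (fineP L m) c₀ W) (b : Bond d (fineP L m)),
      WL2.equiv ℂ _ W (χS' z f) b = (B5SmoothPartition.hS (fineP L m) M₀ z (bpos b) : ℂ) • WL2.equiv ℂ _ W f b)
    (hχE : ∀ z (g : BondL2K ℂ d m c₁ W) (c : Bond d m),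
      WL2.equiv ℂ _ W (χE' z g) c = (B5SmoothPartition.hS (fineP L m) M₀ z (perSite (fineP L m) (cornerSite L c.1)) : ℂ) • WL2.equiv ℂ _ W g c)
    (f : BondL2K ℂ d (fineP L m) c₀ W) :
    ∑ z : Ctr (fineP L m) M₀, ‖QtorusW L m hL φ (fun _ => 1) hα1' hU1' hreg' (c₁ := c₁) (χS' z f)‖ ^ 2 ≤
      ‖QtorusW L m hL φ (fun _ => 1) hα1' hU1' hreg' (c₁ := c₁) f‖ ^ 2 +
        (256 * d * ((L : ℝ) - 1) ^ 2 / (M₀ : ℝ) ^ 2 * (c₁ / (c₀ * (L : ℝ) ^ d)) +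
          256 * d * ((L : ℝ) - 1) ^ 2 / (M₀ : ℝ) ^ 2 * (c₁ / (c₀ * (L : ℝ) ^ d))) * ‖f‖ ^ 2 :=
  sum_norm_sq_QtorusW_one_localised_le L m hL hα1' hU1' hreg' φ Finset.univ (fun c => perSite (fineP L m) (cornerSite L c.1))
    (B5SmoothPartition.hS (fineP L m) M₀) χS' χE' (fun z => hχS z) (fun z => hχE z) (fun x => sum_hS_sq hM hdiv h2N x) (by positivity)
    (fun c r i hi => sum_hS_sweep_sq_le L m hM hdiv h2N c r hi) f

end Smooth

end Literature.MathematicalPhysics.QuantumFieldTheory.Balaban1983to89.B9Eq387IMSAveragingLettersLattice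

end
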